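import Summits.Ventures.HSemireg.UntwistCocycleTwistClass
import HarnessLib

/-!
# Venture HSemireg — route R1.0 (untwisted reading): the TRIVIAL CLASS gives the TRIVIAL TWIST, `E⟨1⟩ ≅ E`
# (th-4 file #31; sequel of `UntwistCocycleTwistClass.lean` #30)

HONEST FRAMING. A construction on the real carriers of `UntwistCocycleTwist.lean` (#11) in `X.Modules` for an arbitrary
scheme `X` and an arbitrary `𝒪_X`-module `E`; no hypothesis. Nothing is asserted about any variety; no gerbe; nothing
here says HC, HC_CM or HC_AV is proved.

WHAT. For the trivial cocycle `1 = UnitCocycle.one X` (`U_x = X`, `g ≡ 1`) the local trivialisations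
`twistTrivOver 1 E x X : E|_X ≅ (E⟨1⟩)|_X` of file #14 do not depend on `x` (the twisting relation reads `s_x = s_y`), so
they glue (`Modules/SheafHom.glueHom` over the point-indexed constant cover — no point of `X` has to be chosen, the
empty scheme included) to **`twistOneIso E : twist (UnitCocycle.one X) E ≅ E`**. With #30 (`twistCongr`): every cocycle
of TRIVIAL CLASS twists trivially — `nonempty_twist_iso_self_of_equiv_one`, `nonempty_twist_iso_self_of_mk_eq_one`
(`[c] = 1 ∈ Ȟ¹(X, 𝒪_X^×)` ⇒ `E⟨c⟩ ≅ E` for every `E`). For route R1.0 this is the bookkeeping sentence «untwisting by a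
line bundle of trivial class changes nothing»: `E₀ ⊗ M ≅ E₀` when `[M] = 0 ∈ Pic`, hence the same `Ext²(E₀, E₀)` (`18` at
the `g = 4` anchor) and the same semiregularity verdict (#32). Which class: `1`; which twist: `- ⊗ 𝒪_X`.

## Contents (everything proved; 0 named facts; 0 sorry)

* `one_g`, `ofTwistOver_one_compatible`, `toTwistOver_one_compatible`, `twistOneOverIso`, **`twistOneIso`**,
  `nonempty_twist_iso_self_of_equiv_one`, `nonempty_twist_iso_self_of_mk_eq_one`.

## References

* R. Hartshorne, *Algebraic Geometry*, GTM 52 (1977), II Ex. 1.22 (glueing), III Ex. 4.5 (`Pic X ≅ Ȟ¹(X, 𝒪_X^×)`).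
  [Hartshorne1977]
-/

noncomputable section

open CategoryTheory AlgebraicGeometry TopologicalSpace Opposite

namespace Summit.Ventures.HSemireg

open Literature.AlgebraicGeometry.Modules

universe u

variable {X : Scheme.{u}} (E : X.Modules)

namespace CocycleTwist

/-- The transition functions of the trivial cocycle are `1`. [folklore] -/
theorem one_g (x y : X) (V : X.Opens) (hx : V ≤ (UnitCocycle.one X).U x) (hy : V ≤ (UnitCocycle.one X).U y) :
    (UnitCocycle.one X).g x y V hx hy = 1 :=
  rfl

/-- For the trivial cocycle (`U_x = X`, `g = 1`) the local trivialisations `s ↦ s_x` over `X` agree for all `x`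
(the relation reads `s_x = s_y`). [folklore] -/
theorem ofTwistOver_one_compatible (x y : X) :
    restrictHom (Opens.infLELeft (⊤ : X.Opens) ⊤) (ofTwistOver (UnitCocycle.one X) E x ⊤ le_top) =
      restrictHom (Opens.infLERight (⊤ : X.Opens) ⊤) (ofTwistOver (UnitCocycle.one X) E y ⊤ le_top) := by
  refine hom_ext_of_appLE fun V k s => ?_
  rw [appLE_restrictHom, appLE_restrictHom, appLE_ofTwistOver, appLE_ofTwistOver]
  have key := comp_rel (UnitCocycle.one X) E s x y (W := V ⊓ ⊤) inf_le_left le_top le_top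
  rw [one_g, one_smul] at key
  have key' := congrArg (E.presheaf.map (homOfLE (le_inf le_rfl le_top : V ≤ V ⊓ ⊤)).op) key
  rw [presheaf_map_map, presheaf_map_map] at key'
  exact key'

/-- For the trivial cocycle the local trivialisations `e ↦ e ⊗ t_x` over `X` agree for all `x`. [folklore] -/
theorem toTwistOver_one_compatible (x y : X) :
    restrictHom (Opens.infLELeft (⊤ : X.Opens) ⊤) (toTwistOver (UnitCocycle.one X) E x ⊤ le_top) =
      restrictHom (Opens.infLERight (⊤ : X.Opens) ⊤) (toTwistOver (UnitCocycle.one X) E y ⊤ le_top) := by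
  refine hom_ext_of_appLE fun V k e => ?_
  rw [appLE_restrictHom, appLE_restrictHom, appLE_toTwistOver, appLE_toTwistOver]
  refine twist_ext (UnitCocycle.one X) E fun z => ?_
  rw [comp_trivSection, comp_trivSection, one_g, one_g]

/-- The glued isomorphism `(E⟨1⟩)|_{⨆_x X} ≅ E|_{⨆_x X}` (gluing the local trivialisations; phrased through the
point-indexed constant cover so that no point of `X` has to be chosen). [folklore] -/
def twistOneOverIso :
    (twist (UnitCocycle.one X) E).over (iSup fun _ : X => (⊤ : X.Opens)) ≅ E.over (iSup fun _ : X => (⊤ : X.Opens)) where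
  hom := glueHom (fun _ : X => (⊤ : X.Opens)) (fun x => ofTwistOver (UnitCocycle.one X) E x ⊤ le_top)
    (ofTwistOver_one_compatible E)
  inv := glueHom (fun _ : X => (⊤ : X.Opens)) (fun x => toTwistOver (UnitCocycle.one X) E x ⊤ le_top)
    (toTwistOver_one_compatible E)
  hom_inv_id := by
    have hid : ∀ x y : X, restrictHom (Opens.infLELeft (⊤ : X.Opens) ⊤)
        (𝟙 ((twist (UnitCocycle.one X) E).over ((fun _ : X => (⊤ : X.Opens)) x))) =
          restrictHom (Opens.infLERight (⊤ : X.Opens) ⊤)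
            (𝟙 ((twist (UnitCocycle.one X) E).over ((fun _ : X => (⊤ : X.Opens)) y))) := fun x y => by
      rw [restrictHom_id, restrictHom_id]
    have e1 : glueHom (fun _ : X => (⊤ : X.Opens)) (fun x => ofTwistOver (UnitCocycle.one X) E x ⊤ le_top)
          (ofTwistOver_one_compatible E) ≫
        glueHom (fun _ : X => (⊤ : X.Opens)) (fun x => toTwistOver (UnitCocycle.one X) E x ⊤ le_top)
          (toTwistOver_one_compatible E) = glueHom (fun _ : X => (⊤ : X.Opens)) (fun x => 𝟙 _) hid :=
      eq_glueHom _ _ _ _ fun x => by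
        rw [restrictHom_comp, restrictHom_glueHom, restrictHom_glueHom]
        exact (twistTrivOver (UnitCocycle.one X) E x ⊤ le_top).inv_hom_id
    have e2 : (𝟙 _ : (twist (UnitCocycle.one X) E).over (iSup fun _ : X => (⊤ : X.Opens)) ⟶ _) =
        glueHom (fun _ : X => (⊤ : X.Opens)) (fun x => 𝟙 _) hid :=
      eq_glueHom _ _ _ _ fun x => restrictHom_id _
    rw [e1, ← e2]
  inv_hom_id := by
    have hid : ∀ x y : X, restrictHom (Opens.infLELeft (⊤ : X.Opens) ⊤)
        (𝟙 (E.over ((fun _ : X => (⊤ : X.Opens)) x))) =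
          restrictHom (Opens.infLERight (⊤ : X.Opens) ⊤) (𝟙 (E.over ((fun _ : X => (⊤ : X.Opens)) y))) :=
      fun x y => by rw [restrictHom_id, restrictHom_id]
    have e1 : glueHom (fun _ : X => (⊤ : X.Opens)) (fun x => toTwistOver (UnitCocycle.one X) E x ⊤ le_top)
          (toTwistOver_one_compatible E) ≫
        glueHom (fun _ : X => (⊤ : X.Opens)) (fun x => ofTwistOver (UnitCocycle.one X) E x ⊤ le_top)
          (ofTwistOver_one_compatible E) = glueHom (fun _ : X => (⊤ : X.Opens)) (fun x => 𝟙 _) hid :=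
      eq_glueHom _ _ _ _ fun x => by
        rw [restrictHom_comp, restrictHom_glueHom, restrictHom_glueHom]
        exact (twistTrivOver (UnitCocycle.one X) E x ⊤ le_top).hom_inv_id
    have e2 : (𝟙 _ : E.over (iSup fun _ : X => (⊤ : X.Opens)) ⟶ _) =
        glueHom (fun _ : X => (⊤ : X.Opens)) (fun x => 𝟙 _) hid :=
      eq_glueHom _ _ _ _ fun x => restrictHom_id _
    rw [e1, ← e2]

/-- **THE TRIVIAL CLASS GIVES THE TRIVIAL TWIST: `E⟨1⟩ ≅ E`** for the trivial cocycle `1 = (X, g ≡ 1)` and every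
`𝒪_X`-module `E`. [cite: Hartshorne1977, III Ex. 4.5] -/
def twistOneIso : twist (UnitCocycle.one X) E ≅ E :=
  isoOfOverCover (W := fun _ : X => (⊤ : X.Opens)) (fun _ => trivial) (twistOneOverIso E)

/-- **A cocycle of trivial class twists trivially**: a coboundary from `c` to the trivial cocycle gives `E⟨c⟩ ≅ E` for
every `𝒪_X`-module `E` (`twistCongr` of #30 followed by `twistOneIso`). [cite: Hartshorne1977, III Ex. 4.5] -/
def twistIsoSelfOfCoboundaryOne {c : UnitCocycle X} (b : UnitCocycle.Coboundary c (UnitCocycle.one X)) :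
    twist c E ≅ E :=
  twistCongr b E ≪≫ twistOneIso E

/-- `c` cohomologous to the trivial cocycle ⇒ `E⟨c⟩ ≅ E`. [cite: Hartshorne1977, III Ex. 4.5] -/
theorem nonempty_twist_iso_self_of_equiv_one {c : UnitCocycle X} (h : UnitCocycle.Equiv c (UnitCocycle.one X)) :
    Nonempty (twist c E ≅ E) := by
  obtain ⟨b⟩ := h
  exact ⟨twistIsoSelfOfCoboundaryOne E b⟩

/-- **`[c] = 1 ∈ Ȟ¹(X, 𝒪_X^×)` ⇒ `E⟨c⟩ ≅ E`** for every `𝒪_X`-module `E`. [cite: Hartshorne1977, III Ex. 4.5] -/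
theorem nonempty_twist_iso_self_of_mk_eq_one {c : UnitCocycle X} (h : CechPic.mk c = 1) : Nonempty (twist c E ≅ E) :=
  nonempty_twist_iso_self_of_equiv_one E ((CechPic.mk_eq_mk_iff c (UnitCocycle.one X)).1 (h.trans CechPic.mk_one.symm))

end CocycleTwist

end Summit.Ventures.HSemireg

end
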